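import Mathlib
import HarnessLib
import Summits.AtomisticToContinuum.Crystallization.Theorems.PricedLinkCensusSoftFourRingsRigData

/-!
# Soft four-rings, metric half by certified numerics (14): the HCP certificate stream passes the check, II

Route `PricedLinkCensus`, sub-problem `Crystallization`, item `SoftFourRings`
(stmt-AtomisticToContinuum-14234).  The HCP cells from index 83 on are certified and both HCP charts are covered, evaluated by `native_decide` (about 90 s); combined with `…RigCheckHcp1` in `…RigMain`.
-/

namespace Summit.AtomisticToContinuum.Crystallization.Theorems

namespace Rig

/-- **HCP cells `83 …` are certified.** -/
theorem hcp_all_drop : (hcpCells.drop 83).all (runCell hcpModel) = true := by native_decide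

/-- **Both HCP charts are covered by the cells.** -/
theorem hcp_covers : (coversChart hcpCells true && coversChart hcpCells false) = true := by native_decide

end Rig

end Summit.AtomisticToContinuum.Crystallization.Theorems
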